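import Mathlib
import HarnessLib
import Summits.Ventures.LatticeQCDFlow.Exactness.SUNResidualTangentOperator

/-!
# The `C¹` tangent generator whose flow inverts the `SU(N)` residual isotopy, for every `N`

HONEST FRAMING: exact (Metropolis-corrected) sampling algorithms for lattice gauge theory;
figures of merit are autocorrelation/cost numbers at stated couplings and volumes; no
continuum-physics claim.

Venture `LatticeQCDFlow` (cell pub-lqcd), topic `Exactness`; FANOUT row 10 (`eng-equiv`; engine
modules `equiv/residual.py`, `flows_jax/residual_flow.py`).  NEW WORK of the cell, file 4 of the series on
the residual-layer Jacobian for every `N` (after `SUNResidualLayerVelocity`, `SUNResidualIsotopy`,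
`SUNResidualTangentOperator`).  Setting and local notations `famb[τ]`, `Top[τ, W, a]` as there.  No
definition is introduced.

* `exists_contDiff_zero_one_of_isClosed'` — smooth Urysohn on a finite-dimensional real normed space
  (Mathlib's `exists_contMDiffMap_zero_one_of_isClosed` read through `𝓘(ℝ, E)`);
* `exists_contDiff_cutoff_extension` — a field that is `C¹` at every point of an open set `O` agrees
  on any closed `C ⊆ O` with a globally `C¹` field of the form `χ • field`;
* **`exists_residualIsotopy_generator`** — THE GENERATOR.  With the time reparametrisation
  `σ(s) = (1 − cos πs)/2` (so `σ(0) = 0`, `σ(1) = 1`, `|σ| ≤ 1`, `σ′(s) = (π/2) sin πs`) there is a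
  jointly `C¹` field `Z : ℝ → M_n(ℂ)^E → M_n(ℂ)^E` which (i) is tangent — `Z_s(U)_e ∈ 𝔰𝔲(n)` at every
  `SU(n)^E` configuration —, (ii) vanishes on frozen links, and (iii) satisfies, at every `SU(n)^E`
  configuration and every active link `a`,
  `(D_W famb[σ s](U) · single a (Z_s(U)_a U_a))_a = −σ′(s) · Qamb a U · famb[σ s] U a`:
  the velocity that the isotopy imparts to the active link is exactly cancelled.  Construction: on the
  open set `O = {(s, W) : every Top[σ s, W, a] is invertible}` — which contains the closed set
  `ℝ × SU(n)^E` by `isUnit_residualTangentOp` — the explicit field `−σ′(s) Top⁻¹ Qamb a W` is `C¹`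
  (operator inversion is smooth, `contDiffAt_map_inverse`); a smooth Urysohn cut-off extends it.  The
  next file (`SUNResidualLayerJacobian`) shows that the flow of `Z` (row 31's
  `Luscher2010.FlowExistence.flowMap`) satisfies `famb[σ s] ∘ Φ_s = id`, i.e. inverts the layer at
  `s = 1`, and concludes exactness from Lüscher's Jacobian formula.

Printed counterparts, NAMED ONLY: M. Lüscher, CMP 293 (2010) 899, §3; Abbott et al.,
arXiv:2305.02402 §4.2; Morningstar–Peardon, PRD 69 (2004) 054501.
-/

noncomputable section

namespace Summit.Ventures.LatticeQCDFlow.Exactness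

open Literature.MathematicalPhysics.QuantumFieldTheory
open Literature.MathematicalPhysics.QuantumFieldTheory.Luscher2010
open Literature.MathematicalPhysics.QuantumFieldTheory.WilsonFlow
open Filter Set
open scoped Matrix Matrix.Norms.Frobenius Topology ContDiff Manifold

variable {d L n : ℕ} [NeZero L]

/-! ## Smooth cut-offs -/

/-- **Smooth Urysohn lemma** on a finite-dimensional real normed space: disjoint closed sets are
separated by a `C¹` function (`= 0` on the first, `= 1` on the second). -/
theorem exists_contDiff_zero_one_of_isClosed' {E : Type*} [NormedAddCommGroup E] [NormedSpace ℝ E]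
    [FiniteDimensional ℝ E] {s t : Set E} (hs : IsClosed s) (ht : IsClosed t) (hd : Disjoint s t) :
    ∃ χ : E → ℝ, ContDiff ℝ 1 χ ∧ (∀ x ∈ s, χ x = 0) ∧ (∀ x ∈ t, χ x = 1) := by
  obtain ⟨f, hf0, hf1, -⟩ := exists_contMDiffMap_zero_one_of_isClosed (I := 𝓘(ℝ, E)) (M := E)
    (n := 1) hs ht hd
  exact ⟨f, f.contMDiff.contDiff, fun x hx => hf0 hx, fun x hx => hf1 hx⟩

/-- **Cut-off extension.**  If `g` is `C¹` at every point of an open set `O` containing the closed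
set `C`, there is a `C¹` scalar cut-off `χ` with `χ = 1` on `C` such that `χ • g` is `C¹` everywhere
(take `C ⊆ O' ⊆ closure O' ⊆ O` and `χ = 0` off `O'`). -/
theorem exists_contDiff_cutoff_extension {E F : Type*} [NormedAddCommGroup E] [NormedSpace ℝ E]
    [FiniteDimensional ℝ E] [NormedAddCommGroup F] [NormedSpace ℝ F] {O C : Set E} (hO : IsOpen O)
    (hC : IsClosed C) (hCO : C ⊆ O) {g : E → F} (hg : ∀ x ∈ O, ContDiffAt ℝ 1 g x) :
    ∃ χ : E → ℝ, ContDiff ℝ 1 (fun x => χ x • g x) ∧ (∀ x ∈ C, χ x = 1) := by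
  obtain ⟨O', hO'open, hCO', hclO'⟩ := normal_exists_closure_subset hC hO hCO
  obtain ⟨χ, hχ, hχ0, hχ1⟩ := exists_contDiff_zero_one_of_isClosed' hO'open.isClosed_compl hC
    (disjoint_compl_left_iff.2 hCO')
  refine ⟨χ, contDiff_iff_contDiffAt.2 fun x => ?_, hχ1⟩
  by_cases hx : x ∈ O
  · exact hχ.contDiffAt.smul (hg x hx)
  · have hx' : x ∉ closure O' := fun h => hx (hclO' h)
    have hnhds : (closure O')ᶜ ∈ 𝓝 x := isClosed_closure.isOpen_compl.mem_nhds hx'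
    have hev : (fun y => χ y • g y) =ᶠ[𝓝 x] fun _ => 0 := by
      filter_upwards [hnhds] with y hy
      have h0 : χ y = 0 := hχ0 y (fun h => hy (subset_closure h))
      rw [h0, zero_smul]
    exact contDiffAt_const.congr_of_eventuallyEq hev

/-! ## The generator -/

section Generator

variable (p : Edge d L → Prop) [DecidablePred p]
  (Q : {e : Edge d L // p e} → ({f : Edge d L // ¬p f} → Matrix.specialUnitaryGroup (Fin n) ℂ) →
    Matrix (Fin n) (Fin n) ℂ → Matrix (Fin n) (Fin n) ℂ)
  (κ : {e : Edge d L // p e} → ({f : Edge d L // ¬p f} → Matrix.specialUnitaryGroup (Fin n) ℂ) → ℝ)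
  (Qamb : {e : Edge d L // p e} → AmbConfig d L n → Matrix (Fin n) (Fin n) ℂ)

set_option quotPrecheck false in
/-- The residual isotopy at time `τ` (local notation, as in `SUNResidualIsotopy`). -/
local notation "famb[" τ "]" => (fun (W : AmbConfig d L n) (e : Edge d L) =>
  if h : p e then NormedSpace.exp ((τ : ℝ) • Qamb ⟨e, h⟩ W) * W e else W e)

set_option quotPrecheck false in
/-- The block of the tangential operator (local notation, as in `SUNResidualTangentOperator`). -/
local notation "Blk[" τ ", " W ", " a "]" =>
  ((fderiv ℝ (fun Y : Matrix (Fin n) (Fin n) ℂ => Y * ((famb[τ]) W a)ᴴ) 0).comp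
    ((fderiv ℝ (fun W' : AmbConfig d L n => W' a) 0).comp
      ((fderiv ℝ (famb[τ]) W).comp
        ((fderiv ℝ (fun Y : Matrix (Fin n) (Fin n) ℂ => (Pi.single a Y : AmbConfig d L n)) 0).comp
          (fderiv ℝ (fun Y : Matrix (Fin n) (Fin n) ℂ => Y * W a) 0)))))

set_option quotPrecheck false in
/-- The tangential operator (local notation, as in `SUNResidualTangentOperator`). -/
local notation "Top[" τ ", " W ", " a "]" =>
  ((fderiv ℝ (suProj (n := n)) 0).comp ((Blk[τ, W, a]).comp (fderiv ℝ (suProj (n := n)) 0)) +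
    (ContinuousLinearMap.id ℝ (Matrix (Fin n) (Fin n) ℂ) - fderiv ℝ (suProj (n := n)) 0))

/-- **The generator of the inverse residual isotopy.**  Under the engine's certificate (exponents
in `𝔰𝔲(n)`, `κ a y`-Lipschitz with `0 ≤ κ a y < 1`) realised by `C²` ambient exponents, there is a
jointly `C¹`, tangent, frozen-link-free field `Z` with
`(D_W famb[σ s](U) · single a (Z_s(U)_a U_a))_a = −σ′(s) · Qamb a U · famb[σ s] U a`
at every `SU(n)^E` configuration and every active link, `σ(s) = (1 − cos πs)/2`. -/
theorem exists_residualIsotopy_generator (hQ2 : ∀ a, ContDiff ℝ 2 (Qamb a))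
    (hQ : ∀ a y, ∀ U ∈ Matrix.specialUnitaryGroup (Fin n) ℂ, (Q a y U)ᴴ = -Q a y U ∧ (Q a y U).trace = 0)
    (hlip : ∀ a y, ∀ U ∈ Matrix.specialUnitaryGroup (Fin n) ℂ, ∀ V ∈ Matrix.specialUnitaryGroup (Fin n) ℂ,
      frobNorm (Q a y U - Q a y V) ≤ κ a y * frobNorm (U - V))
    (hκ0 : ∀ a y, 0 ≤ κ a y) (hκ : ∀ a y, κ a y < 1)
    (hQambQ : ∀ a (U : GaugeConfig d L (Matrix.specialUnitaryGroup (Fin n) ℂ)),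
      Qamb a (coeConfig U) = Q a (fun f => U f) (U a.1 : Matrix (Fin n) (Fin n) ℂ)) :
    ∃ Z : ℝ → AmbConfig d L n → AmbConfig d L n,
      ContDiff ℝ 1 (fun q : ℝ × AmbConfig d L n => Z q.1 q.2) ∧
      (∀ (s : ℝ) (U : GaugeConfig d L (Matrix.specialUnitaryGroup (Fin n) ℂ)) (e : Edge d L),
        (Z s (coeConfig U) e)ᴴ = -Z s (coeConfig U) e ∧ (Z s (coeConfig U) e).trace = 0) ∧
      (∀ (s : ℝ) (W : AmbConfig d L n) (e : Edge d L), ¬p e → Z s W e = 0) ∧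
      (∀ (s : ℝ) (U : GaugeConfig d L (Matrix.specialUnitaryGroup (Fin n) ℂ)) (a : Edge d L) (ha : p a),
        fderiv ℝ (famb[(1 - Real.cos (Real.pi * s)) / 2]) (coeConfig U)
            (Pi.single a (Z s (coeConfig U) a * (U a : Matrix (Fin n) (Fin n) ℂ))) a =
          -((Real.pi / 2 * Real.sin (Real.pi * s)) • (Qamb ⟨a, ha⟩ (coeConfig U) *
            (NormedSpace.exp (((1 - Real.cos (Real.pi * s)) / 2) • Qamb ⟨a, ha⟩ (coeConfig U)) *
              (U a : Matrix (Fin n) (Fin n) ℂ))))) := by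
  -- operator-valued calculus: the normed structures on the operator spaces, given explicitly
  letI i1 : NormedAddCommGroup (Matrix (Fin n) (Fin n) ℂ →L[ℝ] Matrix (Fin n) (Fin n) ℂ) :=
    ContinuousLinearMap.toNormedAddCommGroup
  letI i2 : NormedSpace ℝ (Matrix (Fin n) (Fin n) ℂ →L[ℝ] Matrix (Fin n) (Fin n) ℂ) :=
    ContinuousLinearMap.toNormedSpace
  letI i3 : NormedAddCommGroup (AmbConfig d L n →L[ℝ] AmbConfig d L n) :=
    ContinuousLinearMap.toNormedAddCommGroup
  letI i4 : NormedSpace ℝ (AmbConfig d L n →L[ℝ] AmbConfig d L n) := ContinuousLinearMap.toNormedSpace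
  letI i5 : NormedAddCommGroup (AmbConfig d L n →L[ℝ] Matrix (Fin n) (Fin n) ℂ) :=
    ContinuousLinearMap.toNormedAddCommGroup
  letI i6 : NormedSpace ℝ (AmbConfig d L n →L[ℝ] Matrix (Fin n) (Fin n) ℂ) :=
    ContinuousLinearMap.toNormedSpace
  letI i7 : NormedAddCommGroup (Matrix (Fin n) (Fin n) ℂ →L[ℝ] AmbConfig d L n) :=
    ContinuousLinearMap.toNormedAddCommGroup
  letI i8 : NormedSpace ℝ (Matrix (Fin n) (Fin n) ℂ →L[ℝ] AmbConfig d L n) :=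
    ContinuousLinearMap.toNormedSpace
  haveI : CompleteSpace (Matrix (Fin n) (Fin n) ℂ) := FiniteDimensional.complete ℝ _
  -- the time reparametrisation
  obtain ⟨σ, hσ⟩ : ∃ σ : ℝ → ℝ, σ = fun s => (1 - Real.cos (Real.pi * s)) / 2 := ⟨_, rfl⟩
  obtain ⟨σ', hσ'⟩ : ∃ σ' : ℝ → ℝ, σ' = fun s => Real.pi / 2 * Real.sin (Real.pi * s) := ⟨_, rfl⟩
  have hσC : ContDiff ℝ 2 σ := by
    rw [hσ]
    exact (contDiff_const.sub (Real.contDiff_cos.comp (contDiff_const.mul contDiff_id))).div_const _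
  have hσ'C : ContDiff ℝ 1 σ' := by
    rw [hσ']
    exact contDiff_const.mul (Real.contDiff_sin.comp (contDiff_const.mul contDiff_id))
  have hσabs : ∀ s, |σ s| ≤ 1 := by
    intro s
    rw [hσ]
    have h1 := Real.cos_le_one (Real.pi * s)
    have h2 := Real.neg_one_le_cos (Real.pi * s)
    rw [abs_le]
    constructor <;> nlinarith
  -- joint smoothness of the reparametrised isotopy
  have hF2 : ContDiff ℝ 2 (fun q : ℝ × AmbConfig d L n => (famb[σ q.1]) q.2) :=
    (contDiff_residualIsotopy p Qamb hQ2).comp ((hσC.comp contDiff_fst).prodMk contDiff_snd)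
  -- (1) the tangential operator is `C¹` in `(s, W)`
  have hTop : ∀ a : Edge d L, ContDiff ℝ 1 (fun q : ℝ × AmbConfig d L n => Top[σ q.1, q.2, a]) := by
    intro a
    have hD : ContDiff ℝ 1 (fun q : ℝ × AmbConfig d L n => fderiv ℝ (famb[σ q.1]) q.2) := by
      have hunc : ContDiff ℝ 2 (Function.uncurry fun (q : ℝ × AmbConfig d L n) (W : AmbConfig d L n) =>
          (famb[σ q.1]) W) := by
        have h1 : (Function.uncurry fun (q : ℝ × AmbConfig d L n) (W : AmbConfig d L n) => (famb[σ q.1]) W) =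
            (fun r : ℝ × AmbConfig d L n => (famb[σ r.1]) r.2) ∘
              (fun z : (ℝ × AmbConfig d L n) × AmbConfig d L n => (z.1.1, z.2)) := by
          funext z
          rfl
        rw [h1]
        exact hF2.comp ((contDiff_fst.comp contDiff_fst).prodMk contDiff_snd)
      exact hunc.fderiv contDiff_snd (by norm_num)
    have hm : ContDiff ℝ 2 (fun q : ℝ × AmbConfig d L n => ((famb[σ q.1]) q.2 a)ᴴ) :=
      contDiff_conjTranspose.comp ((contDiff_eval a).comp hF2)
    have hR : ContDiff ℝ 1 (fun q : ℝ × AmbConfig d L n =>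
        fderiv ℝ (fun Y : Matrix (Fin n) (Fin n) ℂ => Y * ((famb[σ q.1]) q.2 a)ᴴ) 0) := by
      have hunc : ContDiff ℝ 2 (Function.uncurry fun (q : ℝ × AmbConfig d L n)
          (Y : Matrix (Fin n) (Fin n) ℂ) => Y * ((famb[σ q.1]) q.2 a)ᴴ) :=
        contDiff_snd.mul (hm.comp contDiff_fst)
      exact hunc.fderiv contDiff_const (by norm_num)
    have hRW : ContDiff ℝ 1 (fun q : ℝ × AmbConfig d L n =>
        fderiv ℝ (fun Y : Matrix (Fin n) (Fin n) ℂ => Y * q.2 a) 0) := by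
      have hunc : ContDiff ℝ 2 (Function.uncurry fun (q : ℝ × AmbConfig d L n)
          (Y : Matrix (Fin n) (Fin n) ℂ) => Y * q.2 a) :=
        contDiff_snd.mul (((contDiff_eval a).comp contDiff_snd).comp contDiff_fst)
      exact hunc.fderiv contDiff_const (by norm_num)
    have hBlk : ContDiff ℝ 1 (fun q : ℝ × AmbConfig d L n => Blk[σ q.1, q.2, a]) :=
      hR.clm_comp (contDiff_const.clm_comp (hD.clm_comp (contDiff_const.clm_comp hRW)))
    exact (contDiff_const.clm_comp (hBlk.clm_comp contDiff_const)).add contDiff_const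
  -- (2) the open set where every tangential operator is invertible
  obtain ⟨O, hO⟩ : ∃ O : Set (ℝ × AmbConfig d L n), O = {q | ∀ a : {e : Edge d L // p e},
      (Top[σ q.1, q.2, a.1]) ∈ Set.range ((↑) : (Matrix (Fin n) (Fin n) ℂ ≃L[ℝ] Matrix (Fin n) (Fin n) ℂ) →
        Matrix (Fin n) (Fin n) ℂ →L[ℝ] Matrix (Fin n) (Fin n) ℂ)} := ⟨_, rfl⟩
  have hOopen : IsOpen O := by
    have h1 : O = ⋂ a : {e : Edge d L // p e}, (fun q : ℝ × AmbConfig d L n => Top[σ q.1, q.2, a.1]) ⁻¹'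
        Set.range ((↑) : (Matrix (Fin n) (Fin n) ℂ ≃L[ℝ] Matrix (Fin n) (Fin n) ℂ) →
          Matrix (Fin n) (Fin n) ℂ →L[ℝ] Matrix (Fin n) (Fin n) ℂ) := by
      rw [hO]
      ext q
      simp only [Set.mem_setOf_eq, Set.mem_iInter, Set.mem_preimage]
    rw [h1]
    exact isOpen_iInter_of_finite fun a => ContinuousLinearEquiv.isOpen.preimage (hTop a.1).continuous
  -- (3) the closed set `ℝ × SU(n)^E` lies inside `O`
  obtain ⟨C, hC⟩ : ∃ C : Set (ℝ × AmbConfig d L n),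
      C = {q | q.2 ∈ Set.range (coeConfig (d := d) (L := L) (n := n))} := ⟨_, rfl⟩
  have hCclosed : IsClosed C := by
    rw [hC]
    exact (isCompact_range continuous_coeConfig).isClosed.preimage continuous_snd
  have hCO : C ⊆ O := by
    rw [hC, hO]
    rintro ⟨s, W⟩ ⟨U, rfl⟩ a
    have hunit := isUnit_residualTangentOp p Q κ Qamb hQ2 hQ hlip hκ0 hκ hQambQ (hσabs s) U a.2
    exact ⟨ContinuousLinearEquiv.unitsEquiv ℝ _ hunit.unit, by ext x; rfl⟩
  -- (4) the explicit field and its smoothness on `O`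
  obtain ⟨Z₀, hZ₀⟩ : ∃ Z₀ : ℝ × AmbConfig d L n → AmbConfig d L n, Z₀ = fun q e =>
      if h : p e then -(σ' q.1 • ContinuousLinearMap.inverse (Top[σ q.1, q.2, e]) (Qamb ⟨e, h⟩ q.2))
      else 0 := ⟨_, rfl⟩
  have hZ₀C : ∀ q ∈ O, ContDiffAt ℝ 1 Z₀ q := by
    intro q hq
    rw [hO] at hq
    refine contDiffAt_pi.2 fun e => ?_
    by_cases he : p e
    · obtain ⟨e', he'⟩ := hq ⟨e, he⟩
      have he'' : (e' : Matrix (Fin n) (Fin n) ℂ →L[ℝ] Matrix (Fin n) (Fin n) ℂ) = Top[σ q.1, q.2, e] := he'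
      have hinvC : ContDiffAt ℝ 1 ContinuousLinearMap.inverse (Top[σ q.1, q.2, e]) := by
        rw [← he'']
        exact contDiffAt_map_inverse (n := 1) e'
      have h1 : ContDiffAt ℝ 1 (fun q' : ℝ × AmbConfig d L n =>
          ContinuousLinearMap.inverse (Top[σ q'.1, q'.2, e])) q :=
        ContDiffAt.comp (g := ContinuousLinearMap.inverse)
          (f := fun q' : ℝ × AmbConfig d L n => Top[σ q'.1, q'.2, e]) q hinvC (hTop e).contDiffAt
      have h2 : ContDiffAt ℝ 1 (fun q' : ℝ × AmbConfig d L n =>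
          ContinuousLinearMap.inverse (Top[σ q'.1, q'.2, e]) (Qamb ⟨e, he⟩ q'.2)) q :=
        h1.clm_apply (((hQ2 ⟨e, he⟩).of_le (by norm_num)).comp contDiff_snd).contDiffAt
      have h3 : ContDiffAt ℝ 1 (fun q' : ℝ × AmbConfig d L n =>
          -(σ' q'.1 • ContinuousLinearMap.inverse (Top[σ q'.1, q'.2, e]) (Qamb ⟨e, he⟩ q'.2))) q :=
        ((hσ'C.comp contDiff_fst).contDiffAt.smul h2).neg
      simp only [hZ₀, he, ↓reduceDIte]
      simpa only [he, ↓reduceDIte] using h3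
    · simp only [hZ₀, he, ↓reduceDIte]
      exact contDiffAt_const
  -- (5) cut-off extension
  obtain ⟨χ, hχZ, hχ1⟩ := exists_contDiff_cutoff_extension hOopen hCclosed hCO hZ₀C
  -- the value of the field at an `SU(n)^E` configuration, and what the operator does to it
  have hval : ∀ (s : ℝ) (U : GaugeConfig d L (Matrix.specialUnitaryGroup (Fin n) ℂ)) (a : Edge d L)
      (ha : p a), (χ (s, coeConfig U) • Z₀ (s, coeConfig U)) a =
        -(σ' s • ContinuousLinearMap.inverse (Top[σ s, coeConfig U, a]) (Qamb ⟨a, ha⟩ (coeConfig U))) := by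
    intro s U a ha
    have hq : ((s, coeConfig U) : ℝ × AmbConfig d L n) ∈ C := by rw [hC]; exact ⟨U, rfl⟩
    rw [Pi.smul_apply, hχ1 _ hq, one_smul, hZ₀]
    simp only [ha, ↓reduceDIte]
  have hTval : ∀ (s : ℝ) (U : GaugeConfig d L (Matrix.specialUnitaryGroup (Fin n) ℂ)) (a : Edge d L)
      (ha : p a), (Top[σ s, coeConfig U, a]) ((χ (s, coeConfig U) • Z₀ (s, coeConfig U)) a) =
        -(σ' s • Qamb ⟨a, ha⟩ (coeConfig U)) := by
    intro s U a ha
    have hunit := isUnit_residualTangentOp p Q κ Qamb hQ2 hQ hlip hκ0 hκ hQambQ (hσabs s) U ha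
    rw [hval s U a ha, map_neg, ContinuousLinearMap.map_smul,
      residualTangentOp_inverse_apply p Qamb (σ s) (coeConfig U) a hunit]
  have hysu : ∀ (s : ℝ) (U : GaugeConfig d L (Matrix.specialUnitaryGroup (Fin n) ℂ)) (a : Edge d L)
      (ha : p a), suProj (-(σ' s • Qamb ⟨a, ha⟩ (coeConfig U))) = -(σ' s • Qamb ⟨a, ha⟩ (coeConfig U)) := by
    intro s U a ha
    obtain ⟨h1, h2⟩ := residualIsotopyExponent_skew p Q Qamb hQ hQambQ ⟨a, ha⟩ U (σ' s)
    refine suProj_eq_self ?_ ?_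
    · rw [Matrix.conjTranspose_neg, h1, neg_neg]
    · rw [Matrix.trace_neg, h2, neg_zero]
  have htan : ∀ (s : ℝ) (U : GaugeConfig d L (Matrix.specialUnitaryGroup (Fin n) ℂ)) (a : Edge d L)
      (ha : p a), suProj ((χ (s, coeConfig U) • Z₀ (s, coeConfig U)) a) =
        (χ (s, coeConfig U) • Z₀ (s, coeConfig U)) a := fun s U a ha =>
    suProj_eq_self_of_residualTangentOp_eq p Qamb (σ s) (coeConfig U) a (hTval s U a ha) (hysu s U a ha)
  refine ⟨fun s W => χ (s, W) • Z₀ (s, W), ?_, ?_, ?_, ?_⟩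
  · -- jointly `C¹`
    simpa only [Prod.mk.eta] using hχZ
  · -- tangent at `SU(n)^E` configurations
    intro s U e
    beta_reduce
    by_cases he : p e
    · exact (suProj_eq_self_iff _).mp (htan s U e he)
    · have hq : ((s, coeConfig U) : ℝ × AmbConfig d L n) ∈ C := by rw [hC]; exact ⟨U, rfl⟩
      have h0 : (χ (s, coeConfig U) • Z₀ (s, coeConfig U)) e = 0 := by
        rw [Pi.smul_apply, hχ1 _ hq, one_smul, hZ₀]
        simp only [he, ↓reduceDIte]
      rw [h0, Matrix.conjTranspose_zero, neg_zero, Matrix.trace_zero]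
      exact ⟨rfl, rfl⟩
  · -- zero on frozen links
    intro s W e he
    beta_reduce
    rw [Pi.smul_apply, hZ₀]
    simp only [he, ↓reduceDIte, smul_zero]
  · -- the cancellation identity on active links
    intro s U a ha
    have hq : ((s, coeConfig U) : ℝ × AmbConfig d L n) ∈ C := by rw [hC]; exact ⟨U, rfl⟩
    obtain ⟨hx1, hx2⟩ := (suProj_eq_self_iff _).mp (htan s U a ha)
    have hT := hTval s U a ha
    rw [residualTangentOp_apply, htan s U a ha, sub_self, add_zero] at hT
    simp only [ha, ↓reduceDIte, coeConfig_apply] at hT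
    obtain ⟨⟨h1, h2⟩, -⟩ :=
      fderiv_residualIsotopy_single_self p Q κ Qamb hQ2 hQ hlip hQambQ (σ s) U ha hx1 hx2
    rw [suProj_eq_self h1 h2] at hT
    -- `δ fᴴ = -(σ' s • Q)`, hence `δ = -(σ' s • Q) f`
    have hfmem : NormedSpace.exp (σ s • Qamb ⟨a, ha⟩ (coeConfig U)) * (U a : Matrix (Fin n) (Fin n) ℂ) ∈
        Matrix.specialUnitaryGroup (Fin n) ℂ := by
      have hm := residualIsotopy_mem p Q Qamb hQ hQambQ (σ s) U a
      simpa only [ha, ↓reduceDIte, coeConfig_apply] using hm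
    have hfU : star (NormedSpace.exp (σ s • Qamb ⟨a, ha⟩ (coeConfig U)) * (U a : Matrix (Fin n) (Fin n) ℂ)) *
        (NormedSpace.exp (σ s • Qamb ⟨a, ha⟩ (coeConfig U)) * (U a : Matrix (Fin n) (Fin n) ℂ)) = 1 :=
      Matrix.mem_unitaryGroup_iff'.mp (Matrix.mem_specialUnitaryGroup_iff.mp hfmem).1
    have hσs : (1 - Real.cos (Real.pi * s)) / 2 = σ s := by rw [hσ]
    have hσ's : Real.pi / 2 * Real.sin (Real.pi * s) = σ' s := by rw [hσ']
    beta_reduce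
    rw [hσs, hσ's]
    rw [show -(σ' s • (Qamb ⟨a, ha⟩ (coeConfig U) *
        (NormedSpace.exp (σ s • Qamb ⟨a, ha⟩ (coeConfig U)) * (U a : Matrix (Fin n) (Fin n) ℂ)))) =
        -(σ' s • Qamb ⟨a, ha⟩ (coeConfig U)) *
          (NormedSpace.exp (σ s • Qamb ⟨a, ha⟩ (coeConfig U)) * (U a : Matrix (Fin n) (Fin n) ℂ)) by
      rw [neg_mul, smul_mul_assoc], ← hT, Matrix.mul_assoc, ← Matrix.star_eq_conjTranspose, hfU,
      Matrix.mul_one]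

end Generator

end Summit.Ventures.LatticeQCDFlow.Exactness

end
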